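import Summits.Ventures.PercRepro.S1DisjointSumCount

/-!
# PercRepro — THE `U`-SET OF A DISJOINT SUM IS A CONVOLUTION OF THE PARTS' PROFILES (p2, gen 27; SUBCLAIM-S1
§6.10 (xvii)(a))

The summation over the slices: `#U(M ⊕ N; p, q) = Σ_{a₁ ≤ p, b₁ ≤ q} |N_M(a₁, b₁)| · |N_N(p − a₁, q − b₁)|`, from
`disjointSum_mem_U_iff` (which slices occur), `disjointSum_ncard_profile_slice_eq_mul` (each slice is a product)
and `Set.Finite.ncard_biUnion` (the slices are pairwise disjoint — the trace ranks determine the slice). Nothing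
is claimed about any cell.

* `uSlice` — the slice of subsets of `M.E ∪ N.E` with prescribed trace ranks;
* `uSet_eq_biUnion_uSlice` — the `U`-set is the union of the slices with `a₁ + a₂ = p`, `b₁ + b₂ = q`;
* **`disjointSum_ncard_U_eq_finsum`** — the convolution formula.
Axioms: standard.
-/

open scoped Matroid

namespace PercRepro

namespace S1

open Set

variable {α : Type}

/-- The slice of the subsets of `M.E ∪ N.E` with trace ranks `a₁`, `a₂` and complement-trace ranks `b₁`, `b₂`. -/
def uSlice (M N : Matroid α) (a₁ b₁ a₂ b₂ : ℕ) : Set (Set α) :=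
  {A : Set α | A ⊆ M.E ∪ N.E ∧ M.eRk (A ∩ M.E) = a₁ ∧ M.eRk (M.E \ A) = b₁ ∧
    N.eRk (A ∩ N.E) = a₂ ∧ N.eRk (N.E \ A) = b₂}

/-- **The `U`-set of a disjoint sum is the union of its slices** over `(a₁, b₁) ∈ [0, p] × [0, q]`, the
complementary ranks being `p − a₁` and `q − b₁`. -/
theorem uSet_eq_biUnion_uSlice (M N : Matroid α) [M.Finite] [N.Finite] (h : Disjoint M.E N.E) (p q : ℕ) :
    {A : Set α | A ⊆ (M.disjointSum N h).E ∧ (M.disjointSum N h).eRk A = p ∧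
        (M.disjointSum N h).eRk ((M.disjointSum N h).E \ A) = q} =
      ⋃ x ∈ ((Finset.range (p + 1) ×ˢ Finset.range (q + 1) : Finset (ℕ × ℕ)) : Set (ℕ × ℕ)),
        uSlice M N x.1 x.2 (p - x.1) (q - x.2) := by
  ext A
  simp only [mem_setOf_eq, mem_iUnion, Finset.mem_coe, Finset.mem_product, Finset.mem_range, exists_prop]
  rw [disjointSum_mem_U_iff M N h p q A]
  constructor
  · rintro ⟨hA, a₁, a₂, b₁, b₂, hp, hq, h1, h2, h3, h4⟩
    refine ⟨(a₁, b₁), ⟨by omega, by omega⟩, hA, h1, h3, ?_, ?_⟩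
    · show N.eRk (A ∩ N.E) = ((p - a₁ : ℕ) : ℕ∞)
      rw [h2]; congr 1; omega
    · show N.eRk (N.E \ A) = ((q - b₁ : ℕ) : ℕ∞)
      rw [h4]; congr 1; omega
  · rintro ⟨⟨a₁, b₁⟩, ⟨ha, hb⟩, hA, h1, h3, h2, h4⟩
    exact ⟨hA, a₁, p - a₁, b₁, q - b₁, by omega, by omega, h1, h2, h3, h4⟩

/-- **THE CONVOLUTION FORMULA**: `#U(M ⊕ N; p, q) = Σ_{a₁ ≤ p, b₁ ≤ q} |N_M(a₁, b₁)| · |N_N(p − a₁, q − b₁)|`. -/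
theorem disjointSum_ncard_U_eq_finsum (M N : Matroid α) [M.Finite] [N.Finite] (h : Disjoint M.E N.E)
    (p q : ℕ) :
    {A : Set α | A ⊆ (M.disjointSum N h).E ∧ (M.disjointSum N h).eRk A = p ∧
        (M.disjointSum N h).eRk ((M.disjointSum N h).E \ A) = q}.ncard =
      ∑ᶠ x ∈ ((Finset.range (p + 1) ×ˢ Finset.range (q + 1) : Finset (ℕ × ℕ)) : Set (ℕ × ℕ)),
        (profileSet M x.1 x.2).ncard * (profileSet N (p - x.1) (q - x.2)).ncard := by
  rw [uSet_eq_biUnion_uSlice M N h p q]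
  have hfin : ((Finset.range (p + 1) ×ˢ Finset.range (q + 1) : Finset (ℕ × ℕ)) : Set (ℕ × ℕ)).Finite :=
    Finset.finite_toSet _
  have hslice_fin : ∀ x ∈ ((Finset.range (p + 1) ×ˢ Finset.range (q + 1) : Finset (ℕ × ℕ)) : Set (ℕ × ℕ)),
      (uSlice M N x.1 x.2 (p - x.1) (q - x.2)).Finite := by
    intro x _
    exact (M.ground_finite.union N.ground_finite).finite_subsets.subset (fun A hA => hA.1)
  have hdisj : ((Finset.range (p + 1) ×ˢ Finset.range (q + 1) : Finset (ℕ × ℕ)) : Set (ℕ × ℕ)).PairwiseDisjoint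
      (fun x : ℕ × ℕ => uSlice M N x.1 x.2 (p - x.1) (q - x.2)) := by
    intro x _ y _ hxy
    rw [Function.onFun, Set.disjoint_left]
    rintro A ⟨-, hx1, hx2, -, -⟩ ⟨-, hy1, hy2, -, -⟩
    apply hxy
    have e1 : x.1 = y.1 := by
      have := hx1.symm.trans hy1
      exact_mod_cast this
    have e2 : x.2 = y.2 := by
      have := hx2.symm.trans hy2
      exact_mod_cast this
    exact Prod.ext e1 e2
  rw [Set.Finite.ncard_biUnion hfin hslice_fin hdisj]
  apply finsum_mem_congr rfl
  intro x _
  exact disjointSum_ncard_profile_slice_eq_mul M N h x.1 x.2 (p - x.1) (q - x.2)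

end S1

end PercRepro
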